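import Summits.KontsevichZagierPeriods.Zeta5Search.Certificates.RecordRayCoeffAsymp
import Summits.KontsevichZagierPeriods.Zeta5Search.Certificates.RecordRayStirling
import Summits.KontsevichZagierPeriods.Zeta5Search.Certificates.RecordRayPartnerRate
import Summits.KontsevichZagierPeriods.Zeta5Search.Certificates.RecordRayExponent
import HarnessLib

/-!
# ζ(5) search — certificates: the record ray's DECAY `|L_n| ≤ e^{(−31.545+ε)n}`, unconditionally (cell `pub-zeta5`, cert-2 g2)

HONEST FRAMING: systematic search; no irrationality claim unless certified.

OUR work (Summit side; certifier 2, generation 2). Hypothesis `(Hℓ)` of `RecordRayExponent.record_exponent` — the decay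
of the record ray's approximating form `L_n = ρ(a·n)·(W(b′)F̃₇(b) − W(b)F̃₇(b′)) = Q(a·n)ζ(5) − P_n`
(`Certificates/RecordRayForms`) — is DISCHARGED here with the certified exponent `ℓ = −31.5452 + ε` (printed `−31.55297`):

* `eventually_rho_termNorm_le_exp` — `|ρ(a·n)|·Z_n ≤ e^{50 n log n + (103.9656+ε)n}` (`RecordRayStirling`);
* `eventually_first_wedge_term_le_exp`, `eventually_second_wedge_term_le_exp` — both wedge terms `≤ e^{(−31.5452+ε)n}`:
  `|W(b)|, |W(b′)| ≤ e^{−50 n log n − 9.98 n + o(n)}` (`RecordRayCoeffAsymp`, the two-heights Eisenstein bound with the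
  certified line-profile constant), `F̃₇(b), F̃₇(b′) ≤ Z_n e^{(−125.5308+ε)n}` (`RecordRayDualSeriesFinal`, `RecordRayPartnerRate`);
  the `n log n` terms cancel (`100 − 50 − 50 = 0`) and `139.5564 − 35.5908 − 9.98 − 125.5308 = −31.5452`;
* `eventually_recordForm_le_exp` — **for every `ε > 0`, eventually `|recordForm n| ≤ e^{(−31.5452 + ε)·n}`**;
* `record_exponent_unconditional_decay` — `record_exponent` with `(Hℓ)` discharged: only the denominator hypothesis `(HD)`
  (`D_n P_n ∈ ℤ`, `D_n ≤ e^{λn}`) remains; every `γ ≥ 0` with `γ(λ + 85.08768884) < 85.0519 + 31.5452` is an effective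
  exponent for the record ray's approximations to `ζ(5)` (e.g. `γ ≤ 0.8656` at BZ's `λ = 49.606`, `γ ≤ 0.831` at the
  census's proved `λ = 55.18`).
-/

noncomputable section

open Finset Real Filter Topology

namespace Summit.KontsevichZagierPeriods.Zeta5Search.RecordRay

open Summit.KontsevichZagierPeriods.Zeta5Search.DualSeries
open Summit.KontsevichZagierPeriods.Zeta5Search.DualSeriesBounds
open Summit.KontsevichZagierPeriods.Zeta5Search.WedgeDictionary
open Summit.KontsevichZagierPeriods.Zeta5Search.DualSeriesLemma19 (bRecord)
open Summit.KontsevichZagierPeriods.Zeta5Search.RecordLine (eventually_coeffW_record_le_exp bRecord'_eq)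
open Literature.NumberTheory.Transcendental (zetaValue)
open Literature.NumberTheory.Irrationality.BrownZudilin2022 (vwpDual)

/-- **Rate form of the Stirling bookkeeping**: for every `ε > 0`, eventually
`|ρ(a·n)|·Z_n ≤ e^{50·n·log n + (103.9656 + ε)·n}` (`139.5564 − 35.5908 = 103.9656`). -/
theorem eventually_rho_termNorm_le_exp {ε : ℝ} (hε : 0 < ε) :
    ∀ᶠ n : ℕ in atTop, |(rhoOf (aRec n) : ℝ)| * termNorm (41 * n) (Brec n) ≤
      Real.exp (50 * n * Real.log n + (1039656 / 10000 + ε) * n) := by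
  filter_upwards [eventually_ge_atTop 1,
    eventually_log_linear_le (a := 126) (b := 0) (by norm_num) le_rfl (show (0 : ℝ) < ε / 32 by positivity),
    eventually_log_linear_le (a := 288) (b := 0) (by norm_num) le_rfl (show (0 : ℝ) < ε / 8 by positivity),
    tendsto_natCast_atTop_atTop.eventually_ge_atTop (12 / ε)] with n hn h126 h288 hbig
  have hb : (12 : ℝ) ≤ ε * n := by rwa [div_le_iff₀ hε, mul_comm] at hbig
  rw [add_zero] at h126 h288
  have hZ := termNorm_pos (41 * n) (Brec n)
  have hρ := log_abs_rhoOf_aRec_le hn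
  have hZl := log_termNorm_record_le hn
  -- |ρ| may be bounded through its logarithm only when positive; handle |ρ| = 0 trivially
  rcases (abs_nonneg (rhoOf (aRec n) : ℝ)).eq_or_lt with h0 | hpos
  · rw [← h0, zero_mul]; exact (Real.exp_pos _).le
  rw [← Real.exp_log hpos, ← Real.exp_log hZ, ← Real.exp_add]
  apply Real.exp_le_exp.2
  nlinarith

/-- **THE FIRST WEDGE TERM DECAYS AT RATE `−31.5452`**: for every `ε > 0`, eventually
`|ρ(a·n)|·|W(bRecord' n)|·F̃₇(bRecord n) ≤ e^{(−31.5452 + ε)·n}`. -/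
theorem eventually_first_wedge_term_le_exp {ε : ℝ} (hε : 0 < ε) :
    ∀ᶠ n : ℕ in atTop, |(rhoOf (aRec n) : ℝ)| * |(coeffW (bRecord' n) : ℝ)| * vwpDual 7 (bRecord n) ≤
      Real.exp ((-315452 / 10000 + ε) * n) := by
  have hε3 : 0 < ε / 3 := by positivity
  filter_upwards [eventually_rho_termNorm_le_exp hε3,
    eventually_coeffW_record_le_exp hε3, eventually_vwpDual_record_le_exp hε3] with n hρZ hW hF
  obtain ⟨-, hW'⟩ := hW
  have hρ0 : 0 ≤ |(rhoOf (aRec n) : ℝ)| := abs_nonneg _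
  have hW0 : 0 ≤ |(coeffW (bRecord' n) : ℝ)| := abs_nonneg _
  -- regroup: (|ρ|·Z)·|W′|·(F̃/Z)
  have hFZ : vwpDual 7 (bRecord n) ≤ termNorm (41 * n) (Brec n) * Real.exp ((-1255308 / 10000 + ε / 3) * n) := hF
  calc |(rhoOf (aRec n) : ℝ)| * |(coeffW (bRecord' n) : ℝ)| * vwpDual 7 (bRecord n)
      ≤ |(rhoOf (aRec n) : ℝ)| * |(coeffW (bRecord' n) : ℝ)| *
          (termNorm (41 * n) (Brec n) * Real.exp ((-1255308 / 10000 + ε / 3) * n)) :=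
        mul_le_mul_of_nonneg_left hFZ (mul_nonneg hρ0 hW0)
    _ = (|(rhoOf (aRec n) : ℝ)| * termNorm (41 * n) (Brec n)) * |(coeffW (bRecord' n) : ℝ)| *
          Real.exp ((-1255308 / 10000 + ε / 3) * n) := by ring
    _ ≤ Real.exp (50 * n * Real.log n + (1039656 / 10000 + ε / 3) * n) *
          Real.exp (-50 * n * Real.log n + (-(499 / 50) + ε / 3) * n) *
          Real.exp ((-1255308 / 10000 + ε / 3) * n) := by
        apply mul_le_mul_of_nonneg_right _ (Real.exp_pos _).le
        exact mul_le_mul hρZ hW' hW0 (Real.exp_pos _).le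
    _ = Real.exp ((-315452 / 10000 + ε) * n) := by
        rw [← Real.exp_add, ← Real.exp_add]
        congr 1
        ring

/-- **THE SECOND WEDGE TERM DECAYS AT RATE `−31.5452`**: for every `ε > 0`, eventually
`|ρ(a·n)|·|W(bRecord n)|·F̃₇(bRecord' n) ≤ e^{(−31.5452 + ε)·n}`. -/
theorem eventually_second_wedge_term_le_exp {ε : ℝ} (hε : 0 < ε) :
    ∀ᶠ n : ℕ in atTop, |(rhoOf (aRec n) : ℝ)| * |(coeffW (bRecord n) : ℝ)| * vwpDual 7 (bRecord' n) ≤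
      Real.exp ((-315452 / 10000 + ε) * n) := by
  have hε3 : 0 < ε / 3 := by positivity
  filter_upwards [eventually_rho_termNorm_le_exp hε3,
    eventually_coeffW_record_le_exp hε3, eventually_vwpDual_record'_le_exp hε3] with n hρZ hW hF
  obtain ⟨hW', -⟩ := hW
  have hρ0 : 0 ≤ |(rhoOf (aRec n) : ℝ)| := abs_nonneg _
  have hW0 : 0 ≤ |(coeffW (bRecord n) : ℝ)| := abs_nonneg _
  calc |(rhoOf (aRec n) : ℝ)| * |(coeffW (bRecord n) : ℝ)| * vwpDual 7 (bRecord' n)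
      ≤ |(rhoOf (aRec n) : ℝ)| * |(coeffW (bRecord n) : ℝ)| *
          (termNorm (41 * n) (Brec n) * Real.exp ((-1255308 / 10000 + ε / 3) * n)) :=
        mul_le_mul_of_nonneg_left hF (mul_nonneg hρ0 hW0)
    _ = (|(rhoOf (aRec n) : ℝ)| * termNorm (41 * n) (Brec n)) * |(coeffW (bRecord n) : ℝ)| *
          Real.exp ((-1255308 / 10000 + ε / 3) * n) := by ring
    _ ≤ Real.exp (50 * n * Real.log n + (1039656 / 10000 + ε / 3) * n) *
          Real.exp (-50 * n * Real.log n + (-(499 / 50) + ε / 3) * n) *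
          Real.exp ((-1255308 / 10000 + ε / 3) * n) := by
        apply mul_le_mul_of_nonneg_right _ (Real.exp_pos _).le
        exact mul_le_mul hρZ hW' hW0 (Real.exp_pos _).le
    _ = Real.exp ((-315452 / 10000 + ε) * n) := by
        rw [← Real.exp_add, ← Real.exp_add]
        congr 1
        ring

/-- **THE RECORD RAY DECAYS: `|L_n| ≤ e^{(−31.5452 + ε)·n}` eventually, for every `ε > 0`** (hypothesis `(Hℓ)` of
`record_exponent`, now a theorem). -/
theorem eventually_recordForm_le_exp {ε : ℝ} (hε : 0 < ε) :
    ∀ᶠ n : ℕ in atTop, |recordForm n| ≤ Real.exp ((-315452 / 10000 + ε) * n) := by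
  have hε2 : 0 < ε / 2 := by positivity
  filter_upwards [eventually_ge_atTop 1, eventually_first_wedge_term_le_exp hε2,
    eventually_second_wedge_term_le_exp hε2, tendsto_natCast_atTop_atTop.eventually_ge_atTop (2 / ε)]
    with n hn h1 h2 hbig
  have hb : (2 : ℝ) ≤ ε * n := by rwa [div_le_iff₀ hε, mul_comm] at hbig
  have hF0 : 0 ≤ vwpDual 7 (bRecord n) := by
    rw [bRecord_eq_natB]; exact (vwpDual_seven_pos (hle_rec n) (hs_rec n)).le
  have hF0' : 0 ≤ vwpDual 7 (bRecord' n) := by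
    rw [bRecord'_eq]; exact (vwpDual_seven_pos (hle_rec' hn) (hs_rec' n)).le
  have habs : |recordForm n| ≤ |(rhoOf (aRec n) : ℝ)| * |(coeffW (bRecord' n) : ℝ)| * vwpDual 7 (bRecord n) +
      |(rhoOf (aRec n) : ℝ)| * |(coeffW (bRecord n) : ℝ)| * vwpDual 7 (bRecord' n) := by
    unfold recordForm
    rw [abs_mul]
    have h := abs_sub ((coeffW (bRecord' n) : ℝ) * vwpDual 7 (bRecord n)) ((coeffW (bRecord n) : ℝ) * vwpDual 7 (bRecord' n))
    rw [abs_mul, abs_mul, abs_of_nonneg hF0, abs_of_nonneg hF0'] at h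
    have hρ0 : 0 ≤ |(rhoOf (aRec n) : ℝ)| := abs_nonneg _
    nlinarith
  -- 2·e^{(ℓ+ε/2)n} ≤ e^{(ℓ+ε)n}
  have htwo : (2 : ℝ) * Real.exp ((-315452 / 10000 + ε / 2) * n) ≤ Real.exp ((-315452 / 10000 + ε) * n) := by
    have h2 : (2 : ℝ) ≤ Real.exp (ε / 2 * n) := by
      have := Real.add_one_le_exp (ε / 2 * n); nlinarith
    calc (2 : ℝ) * Real.exp ((-315452 / 10000 + ε / 2) * n)
        ≤ Real.exp (ε / 2 * n) * Real.exp ((-315452 / 10000 + ε / 2) * n) :=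
          mul_le_mul_of_nonneg_right h2 (Real.exp_pos _).le
      _ = Real.exp ((-315452 / 10000 + ε) * n) := by rw [← Real.exp_add]; congr 1; ring
  linarith

/-- **The record ray's effective exponent with `(Hℓ)` discharged.** Only the denominator hypothesis `(HD)` remains:
given `D_n` with `D_n P_n ∈ ℤ`, `0 < D_n ≤ e^{λn}` eventually, every `γ ≥ 0` with `γ(λ + 85.08768884) < 85.0519 + 31.5452`
is an effective irrationality-type exponent of the record approximations `P_n/Q(a·n) → ζ(5)`:
eventually `|ζ(5) − P_n/Q(a·n)| < 1/q_n^γ` with `q_n = D_n|Q(a·n)|`, `p_n = D_n P_n ∈ ℤ`. -/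
theorem record_exponent_unconditional_decay {lam γ : ℝ} (D : ℕ → ℕ)
    (hD : ∀ᶠ n : ℕ in atTop, 0 < D n ∧ (∃ z : ℤ, (D n : ℚ) * recordP n = z) ∧ (D n : ℝ) ≤ Real.exp (lam * n))
    (hγ : 0 ≤ γ) (hrate : γ * (lam + 8508768884 / 10 ^ 8) < 850519 / 10 ^ 4 + 315452 / 10000) :
    ∀ᶠ n : ℕ in atTop, ∃ p : ℤ, ∃ q : ℕ, 1 ≤ q ∧ (q : ℤ) = D n * |recordQ n| ∧ (p : ℚ) = D n * recordP n ∧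
      |zetaValue 5 - (recordP n : ℝ) / (recordQ n : ℝ)| < 1 / (q : ℝ) ^ γ := by
  set ε : ℝ := (850519 / 10 ^ 4 + 315452 / 10000 - γ * (lam + 8508768884 / 10 ^ 8)) / 2 with hε
  have hεpos : 0 < ε := by rw [hε]; linarith
  exact record_exponent D (eventually_recordForm_le_exp hεpos) hD hγ (by rw [hε]; linarith)

/-- **Headline arithmetic (certified decay).** With the CERTIFIED `ℓ = −31.5452` and Brown–Zudilin's denominator rate
`λ = 49.606`, every `γ ≤ 0.8656` satisfies the rate condition (printed worthiness `0.86597` with `ℓ = −31.55297`);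
with the census's proved `λ = 55.18`, every `γ ≤ 0.8312`. -/
theorem record_exponent_rates_certified {γ : ℝ} :
    (γ ≤ 8656 / 10 ^ 4 → γ * (49606 / 10 ^ 3 + 8508768884 / 10 ^ 8) < 850519 / 10 ^ 4 + (315452 / 10000 : ℝ)) ∧
    (γ ≤ 8312 / 10 ^ 4 → γ * (55180 / 10 ^ 3 + 8508768884 / 10 ^ 8) < 850519 / 10 ^ 4 + (315452 / 10000 : ℝ)) := by
  constructor <;> intro hγ <;> nlinarith

end Summit.KontsevichZagierPeriods.Zeta5Search.RecordRay
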